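import Summits.QuantumFields.YangMills.Theorems.BalabanUVNodesN20KeyedGasResponseLetter

/-!
# BalabanUVNodes ∕ node N20 (NE7b) — (R′‑poly) FROM CAUCHY'S ESTIMATE: the per-polymer two-run current matching of the hellinger road's R-side from an ANALYTIC, UNIFORMLY
# SMALL two-run log-activity ratio on a complex source disc, and the road END TO END at the keyed gas with the R-side's two-run letter in SUP form

Cell `pub-ymgap` (HUMAN RULING D-0062 Track A ∕ director-ym R399 (3a) second-wave width seats), WIDTH SEAT `pub-ymgap-dag-n20-w5` (node n20 = NE7b),
generation g5, CLAIM-4 ∕ INTENT-4 (bus).  Key item K3⁸ `SpineGivenEndpointR13SepCoPHV` (stmt-QuantumFields-27366; skeleton of record v6 b4e55110ab73e679, stub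
`stub_expansion13HV`) — K3⁷ stmt-QuantumFields-20544 aside; filed `--kind proof --supports … --as helper`.  COUNT-NEUTRAL.  THEOREMS ONLY (0 `def`, 0 `instance`,
0 `notation`, 0 `sorry`).  ADDITIVE — imports this seat's `…N20KeyedGasResponseLetter` ONLY (CLAIM-3; hence `…N20KeyedGasClassCurrent`, p626582, p627953); Mathlib's
Cauchy estimate `Complex.norm_deriv_le_of_forall_mem_sphere_norm_le` and `HasDerivAt.real_of_complex` BY NAME; modifies nothing.

WHY.  After `…N20KeyedGasResponseLetter` the R-side of the hellinger road at the keyed gas is three PER-POLYMER letters on the `≤ ν` source-carrying polymers of a class: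
member currents (one run), localisation, and the two-run CURRENT MATCHING (R′‑poly) `|b'_γ∕b_γ − a'_γ∕a_γ| ≤ ρ₁ K`, `Σ ρ₁ < ∞` — a letter about SOURCE DERIVATIVES.  The
programme's generating functions are analytic in the source ([I] p.263 «C^∞ (or analytic)», TABLE row n22), and a two-run comparison of final-scale activities is naturally a
SUP statement.  THIS FILE converts one into the other by Cauchy's estimate: if the two-run log-activity ratio `u_γ = log b_γ − log a_γ` of a source-carrying polymer extends,
around each real source point `s` of the window, to a function `E` complex-differentiable on the disc of radius `R` and bounded by `ε_K` on its boundary circle, then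
`|u'_γ(s)| ≤ ε_K ∕ R` — so (R′‑poly) holds with `ρ₁ K := ε_K ∕ R`, and `Σ ε_K < ∞` is the summability letter.
* §1 [folklore: Cauchy's estimate] ★★ `abs_deriv_le_of_analyticExtension` — a real function `u` with derivative `u'` at `s` whose values near `s` are the real trace of a
  `DiffContOnCl` function `E` on `ball s R` with `‖E‖ ≤ ε` on `sphere s R` has `|u'| ≤ ε ∕ R` (`HasDerivAt.real_of_complex`, uniqueness of derivatives,
  `Complex.norm_deriv_le_of_forall_mem_sphere_norm_le`; LOCATED PRIOR KERNEL: the complex-derivative form at a real centre is dag-n22's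
  `…N22LastCouplingHolo.norm_deriv_le_of_supLetter_closedBall` — this is its REAL-TRACE form, not a restatement) · ★★ `currentMatching_of_analyticIncrement` — the case
  `u = log b − log a`, `u' = b'∕b − a'∕a` (positive activities).
* §2 ★★★ `currentMatchingLetter_of_analyticIncrements` — ALONG `K` at the keyed gas: for every `K`, every `|s| ≤ l₀` and every source-carrying polymer `γ ∈ Λ K ∩ N K` an
  analytic extension of `x ↦ log b K x γ − log a K x γ` on `ball s R` bounded by `ε K` on the circle ((U‑poly)), positivity and derivative letters at `s` ⇒ (R′‑poly) with
  `ρ₁ K := ε K ∕ R`.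
* §3 ★★★ `exists_hybridNE7_keyedGas_of_affinityDefectLetter_analyticIncrements` — `…N20KeyedGasResponseLetter` §3 with (R′‑poly) SUPPLIED by §2: (H) ∃-shape + per-polymer
  positivity ∕ differentiability ∕ localisation ×2 ∕ run A's member currents ∕ (U‑poly) with `ε ≥ 0`, `Σ ε < ∞` ∕ packing ⇒
  `∃ η Wsh shA shB, (H) ∧ Σ√η<∞ ∧ budget bounds ∧ HybridNE7 l₀ vol T A B ∅ 0 shA shB Wsh (K ↦ l₀·(ν·(ε K∕R) + 2√(2η_K)·M₀ν)∕vol)`.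
* §4 toys (A6): `toy_currentMatching_shift` — §1 on `a = exp`, `b = exp(· + c)` (ratio `e^c`, extension the constant `c`, bound `‖c‖`: `|1 − 1| ≤ ‖c‖∕R`, every hypothesis
  genuinely met); `toy_hybridNE7_noPolymers_analytic` — §3 on the empty polymer system.
READING (located, nothing proposed).  (i) (U‑poly) — «for the polymers through the loop's blocks at the final scale, the activities computed by runs of length `K` and
`K + 1` have log-ratio analytic and `≤ ε_K` in modulus on a complex source disc of FIXED radius `R` around the real window, `Σ_K ε_K < ∞`» — is the R-side's two-run letter
in the same SUP currency as the V-side's tilt bound `𝔅` ((KR)), but PER POLYMER and SMALL (the V-side only needs bounded); it is UNPRINTED for d = 4 like (R′); this file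
does not make it smaller, only puts it in the form a two-run comparison theorem would deliver.  (ii) `R` is K-uniform by choice (any fixed complex neighbourhood of the real
window); the road's rate is `ε_K∕R`.  (iii) Nothing here touches (H)'s suppliers or the packing letter.

HONEST FRAMING.  [folklore] Cauchy's estimate + finite-sum bookkeeping + by-name transfer through `…N20KeyedGasResponseLetter` (hence `…N20KeyedGasClassCurrent`, p626582,
p623765, p619159, p609004); (U‑poly), member currents, localisation, positivity, differentiability, packing and (H)'s suppliers' letters are HYPOTHESES produced by
nobody — (U‑poly) and (V‑b) two-run, UNPRINTED for d = 4; NO estimate of Bałaban's programme is proved; nothing of Bałaban's asserted or instantiated (no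
`Provisos₁₃SepCoPH` tuple — K0⁷ OPEN); NE7 ∕ NE7b ∕ NE7c NOT PRINTED as two-run statements for d = 4 and NOT proved; N19′ ∕ N20 ∕ N21 NOT discharged; K3⁸ OPEN (v6
STANDS), K3⁷ aside, neither claimed; no summit statement is proved by this seat; counts UNMOVED (typed 28∕28 · discharged 5∕28; 5∕27 excl. NODE O).  One finite
four-torus programme at fixed ε — NOT ℝ⁴, NOT infinite volume, NOT OS, NOT a mass gap, NOT the Clay problem (R4 closes the conditional finite-𝕋⁴ rung `BalabanLadder.UV`
only).  0 `def`; 0 `sorry`; standard axioms; no cite tags.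
-/

noncomputable section

namespace Summit.QuantumFields.YangMills.BalabanUVNodes.N20KeyedGasCurrentMatchingOfAnalyticIncrement

open Finset Complex Metric
open Literature.Probability.LatticeModels (IsCompatible)
open Literature.MathematicalPhysics.QuantumFieldTheory.Balaban1983to89
open T4MatchingAssembly (HybridNE7)
open Summit.QuantumFields.YangMills.BalabanUVNodes.N20KeyedGasClassCurrent (keyedCarrier_empty)
open Summit.QuantumFields.YangMills.BalabanUVNodes.N20KeyedGasResponseLetter (exists_hybridNE7_keyedGas_of_affinityDefectLetter_and_polymerLetters)

/-! ## §1 Cauchy's estimate on the real trace [folklore] -/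
section Cauchy

/-- **★★ CAUCHY'S ESTIMATE ON THE REAL TRACE** [folklore].  A real function `u` with derivative `u'` at `s` whose values on `|x − s| < R` are the real trace of a function
`E : ℂ → ℂ` complex-differentiable on `ball s R` and continuous on its closure (`DiffContOnCl`), with `‖E z‖ ≤ ε` on `sphere s R` (`0 < R`) ⇒ `|u'| ≤ ε ∕ R`:
`u' = Re E'(s)` by `HasDerivAt.real_of_complex` + uniqueness, and `‖E'(s)‖ ≤ ε∕R` by Mathlib's `Complex.norm_deriv_le_of_forall_mem_sphere_norm_le`. -/
theorem abs_deriv_le_of_analyticExtension {u : ℝ → ℝ} {u' s R ε : ℝ} (hR : 0 < R) (hu : HasDerivAt u u' s)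
    (E : ℂ → ℂ) (hE : DiffContOnCl ℂ E (ball (s : ℂ) R)) (hext : ∀ x : ℝ, |x - s| < R → E x = (u x : ℂ))
    (hε : ∀ z ∈ sphere (s : ℂ) R, ‖E z‖ ≤ ε) : |u'| ≤ ε / R := by
  have hdE : HasDerivAt E (deriv E (s : ℂ)) (s : ℂ) := (hE.differentiableAt isOpen_ball (mem_ball_self hR)).hasDerivAt
  have hre : HasDerivAt (fun x : ℝ => (E x).re) (deriv E (s : ℂ)).re s := hdE.real_of_complex
  have hev : (fun x : ℝ => (E x).re) =ᶠ[nhds s] u := by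
    have hopen : IsOpen {x : ℝ | |x - s| < R} := by
      have : {x : ℝ | |x - s| < R} = ball s R := by ext x; simp [Real.dist_eq]
      rw [this]; exact isOpen_ball
    refine Filter.eventuallyEq_of_mem (hopen.mem_nhds (by simp [hR])) fun x hx => ?_
    rw [Set.mem_setOf_eq] at hx
    rw [hext x hx, ofReal_re]
  rw [hu.unique (hre.congr_of_eventuallyEq hev.symm)]
  exact (abs_re_le_norm _).trans (norm_deriv_le_of_forall_mem_sphere_norm_le hR hE hε)

/-- **★★ THE PER-POLYMER TWO-RUN CURRENT MATCHING FROM AN ANALYTIC, UNIFORMLY SMALL LOG-ACTIVITY RATIO** [folklore].  Activities `a, b : ℝ → ℝ` positive at `s` with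
derivatives `a', b'` there; the two-run log-ratio `x ↦ log b x − log a x` is, on `|x − s| < R`, the real trace of a `DiffContOnCl` function `E` on `ball s R` with
`‖E‖ ≤ ε` on the circle ⇒ `|b'∕b(s) − a'∕a(s)| ≤ ε ∕ R`. -/
theorem currentMatching_of_analyticIncrement {a b : ℝ → ℝ} {a' b' s R ε : ℝ} (hR : 0 < R)
    (ha : 0 < a s) (hb : 0 < b s) (hda : HasDerivAt a a' s) (hdb : HasDerivAt b b' s)
    (E : ℂ → ℂ) (hE : DiffContOnCl ℂ E (ball (s : ℂ) R))
    (hext : ∀ x : ℝ, |x - s| < R → E x = ((Real.log (b x) - Real.log (a x) : ℝ) : ℂ))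
    (hε : ∀ z ∈ sphere (s : ℂ) R, ‖E z‖ ≤ ε) : |b' / b s - a' / a s| ≤ ε / R :=
  abs_deriv_le_of_analyticExtension hR ((hdb.log hb.ne').sub (hda.log ha.ne')) E hE hext hε

end Cauchy

/-! ## §2 Along `K` at the keyed gas: (R′‑poly) from (U‑poly) [folklore] -/
section Letter
variable {P : Type*} {l₀ : ℝ}

/-- **★★★ (R′‑poly) FROM (U‑poly)** [folklore].  Polymer sets `Λ K`, source-carrying sets `N K`, both runs' activities positive and differentiable in the source on
`|s| ≤ l₀`; (U‑poly): a FIXED radius `R > 0` and rates `ε K` such that for every `K`, `|s| ≤ l₀`, `γ ∈ Λ K` with `γ ∈ N K` the log-activity ratio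
`x ↦ log b K x γ − log a K x γ` is on `|x − s| < R` the real trace of a `DiffContOnCl` function on `ball s R` bounded by `ε K` on the circle ⇒ the per-polymer two-run
current matching letter of `…N20KeyedGasResponseLetter` with `ρ₁ K := ε K ∕ R`. -/
theorem currentMatchingLetter_of_analyticIncrements (Λ N : ℕ → Finset P) (a b a' b' : ℕ → ℝ → P → ℝ) {R : ℝ} (hR : 0 < R) (ε : ℕ → ℝ)
    (ha : ∀ K s, |s| ≤ l₀ → ∀ γ ∈ Λ K, 0 < a K s γ) (hb : ∀ K s, |s| ≤ l₀ → ∀ γ ∈ Λ K, 0 < b K s γ)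
    (hda : ∀ K s, |s| ≤ l₀ → ∀ γ ∈ Λ K, HasDerivAt (fun u => a K u γ) (a' K s γ) s)
    (hdb : ∀ K s, |s| ≤ l₀ → ∀ γ ∈ Λ K, HasDerivAt (fun u => b K u γ) (b' K s γ) s)
    (hU : ∀ K s, |s| ≤ l₀ → ∀ γ ∈ Λ K, γ ∈ N K → ∃ E : ℂ → ℂ, DiffContOnCl ℂ E (ball (s : ℂ) R) ∧
      (∀ x : ℝ, |x - s| < R → E x = ((Real.log (b K x γ) - Real.log (a K x γ) : ℝ) : ℂ)) ∧
      (∀ z ∈ sphere (s : ℂ) R, ‖E z‖ ≤ ε K)) :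
    ∀ K s, |s| ≤ l₀ → ∀ γ ∈ Λ K, γ ∈ N K → |b' K s γ / b K s γ - a' K s γ / a K s γ| ≤ ε K / R := by
  intro K s hs γ hγ hγN
  obtain ⟨E, hE, hext, hεb⟩ := hU K s hs γ hγ hγN
  exact currentMatching_of_analyticIncrement hR (ha K s hs γ hγ) (hb K s hs γ hγ) (hda K s hs γ hγ) (hdb K s hs γ hγ) E hE hext hεb

end Letter

/-! ## §3 END TO END at the keyed gas with the R-side's two-run letter in SUP form [by-name through `…N20KeyedGasResponseLetter`] -/
section Road
variable {P : Type*} [DecidableEq P] (inc : P → P → Prop) [DecidableRel inc] {l₀ vol : ℝ}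

/-- **★★★ `HybridNE7` AT THE KEYED GAS FROM THE (H) LETTER, PER-POLYMER LETTERS AND (U‑poly)** [folklore + by-name: `…N20KeyedGasResponseLetter`
`exists_hybridNE7_keyedGas_of_affinityDefectLetter_and_polymerLetters` with (R′‑poly) supplied by `currentMatchingLetter_of_analyticIncrements`].  Letters: per-polymer
positivity ∕ differentiability of both runs' activities on `|s| ≤ l₀`; E1∕E2; (H) ∃-shape at the keyed carriers (ANY supplier); source-carrying sets `N K` with
localisation for both runs; run A's member currents `|a'| ≤ M₀a` on `N K`; (U‑poly) at a fixed radius `R > 0` with rates `ε K ≥ 0`, `Σ ε < ∞`; packing `|X ∩ N K| ≤ ν`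
⇒ `∃ η Wsh shA shB, (H) ∧ Σ√η<∞ ∧ budget bounds ∧ HybridNE7 l₀ vol T A B ∅ 0 shA shB Wsh (K ↦ l₀·(ν·(ε K∕R) + 2√(2η_K)·M₀ν)∕vol)`. -/
theorem exists_hybridNE7_keyedGas_of_affinityDefectLetter_analyticIncrements (hl₀ : 0 ≤ l₀) (hvol : 0 < vol)
    (Λ : ℕ → Finset P) (a b a' b' : ℕ → ℝ → P → ℝ)
    (ha : ∀ K s, |s| ≤ l₀ → ∀ γ ∈ Λ K, 0 < a K s γ) (hb : ∀ K s, |s| ≤ l₀ → ∀ γ ∈ Λ K, 0 < b K s γ)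
    (hda : ∀ K s, |s| ≤ l₀ → ∀ γ ∈ Λ K, HasDerivAt (fun u => a K u γ) (a' K s γ) s)
    (hdb : ∀ K s, |s| ≤ l₀ → ∀ γ ∈ Λ K, HasDerivAt (fun u => b K u γ) (b' K s γ) s)
    {Z : ℕ → ℝ → ℝ}
    (hZA' : ∀ (K : ℕ) (t : ℝ), |t| ≤ l₀ → Z K t = ∑ X ∈ (Λ K).powerset with IsCompatible inc X, ∏ γ ∈ X, a K t γ)
    (hZB' : ∀ (K : ℕ) (t : ℝ), |t| ≤ l₀ → Z (K + 1) t = ∑ X ∈ (Λ K).powerset with IsCompatible inc X, ∏ γ ∈ X, b K t γ)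
    (hHex : ∃ η : ℕ → ℝ, (∀ K, 0 ≤ η K) ∧ Summable (fun K => Real.sqrt (η K)) ∧
      ∀ (K : ℕ) (t : ℝ), |t| ≤ l₀ →
        1 - ∑ X ∈ (Λ K).powerset with IsCompatible inc X,
          Real.sqrt (((∏ γ ∈ X, a K t γ) / ∑ Y ∈ (Λ K).powerset with IsCompatible inc Y, ∏ γ ∈ Y, a K t γ)
            * ((∏ γ ∈ X, b K t γ) / ∑ Y ∈ (Λ K).powerset with IsCompatible inc Y, ∏ γ ∈ Y, b K t γ)) ≤ η K)
    (N : ℕ → Finset P) {M₀ : ℝ} (hM₀ : 0 ≤ M₀) (ν : ℕ)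
    (hlocA : ∀ K s, |s| ≤ l₀ → ∀ γ ∈ Λ K, γ ∉ N K → a' K s γ = 0) (hlocB : ∀ K s, |s| ≤ l₀ → ∀ γ ∈ Λ K, γ ∉ N K → b' K s γ = 0)
    (hcur : ∀ K s, |s| ≤ l₀ → ∀ γ ∈ Λ K, γ ∈ N K → |a' K s γ| ≤ M₀ * a K s γ)
    -- (U‑poly): analytic, uniformly small two-run log-activity ratios on a complex source disc of fixed radius
    {R : ℝ} (hR : 0 < R) (ε : ℕ → ℝ) (hε0 : ∀ K, 0 ≤ ε K) (hεs : Summable ε)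
    (hU : ∀ K s, |s| ≤ l₀ → ∀ γ ∈ Λ K, γ ∈ N K → ∃ E : ℂ → ℂ, DiffContOnCl ℂ E (ball (s : ℂ) R) ∧
      (∀ x : ℝ, |x - s| < R → E x = ((Real.log (b K x γ) - Real.log (a K x γ) : ℝ) : ℂ)) ∧
      (∀ z ∈ sphere (s : ℂ) R, ‖E z‖ ≤ ε K))
    (hν : ∀ K, ∀ X ∈ (Λ K).powerset.filter (fun X => IsCompatible inc X), (X ∩ N K).card ≤ ν) :
    ∃ (η Wsh : ℕ → ℝ) (shA shB : ℕ → ℝ → Finset P → ℝ),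
      (∀ (K : ℕ) (t : ℝ), |t| ≤ l₀ →
        1 - ∑ X ∈ (Λ K).powerset with IsCompatible inc X,
          Real.sqrt (((∏ γ ∈ X, a K t γ) / ∑ Y ∈ (Λ K).powerset with IsCompatible inc Y, ∏ γ ∈ Y, a K t γ)
            * ((∏ γ ∈ X, b K t γ) / ∑ Y ∈ (Λ K).powerset with IsCompatible inc Y, ∏ γ ∈ Y, b K t γ)) ≤ η K) ∧
      Summable (fun K => Real.sqrt (η K)) ∧
      (∀ K, 0 ≤ Wsh K ∧ Wsh K ≤ Real.sqrt (2 * η K) ∧ Wsh K < 1) ∧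
      HybridNE7 l₀ vol (fun K => (Λ K).powerset.filter (fun X => IsCompatible inc X)) (fun K t X => ∏ γ ∈ X, a K t γ) (fun K t X => ∏ γ ∈ X, b K t γ)
        (fun _ _ => ∅) (fun _ => 0) shA shB Wsh
        (fun K => l₀ * ((ν : ℝ) * (ε K / R) + 2 * Real.sqrt (2 * η K) * (M₀ * ν)) / vol) :=
  exists_hybridNE7_keyedGas_of_affinityDefectLetter_and_polymerLetters inc hl₀ hvol Λ a b a' b' ha hb hda hdb hZA' hZB' hHex N hM₀ ν
    (fun K => ε K / R) (fun K => div_nonneg (hε0 K) hR.le) (hεs.div_const R) hlocA hlocB hcur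
    (currentMatchingLetter_of_analyticIncrements Λ N a b a' b' hR ε ha hb hda hdb hU) hν

end Road

/-! ## §4 Toys (A6) [folklore] -/
section Toys

/-- **TOY — SHIFTED EXPONENTIAL ACTIVITIES** (A6 for §1): `a = exp`, `b = exp(· + c)` at `s = 0` with `R = 1`: the log-ratio is the constant `c`, its analytic extension the
constant function, bounded by `‖c‖` on the circle; §1 returns `|e^{c}∕e^{c} − 1∕1| ≤ ‖(c:ℂ)‖ ∕ 1` — every hypothesis genuinely met (the two currents agree: `0 ≤ ‖c‖`). -/
theorem toy_currentMatching_shift (c : ℝ) :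
    |Real.exp (0 + c) / Real.exp (0 + c) - Real.exp 0 / Real.exp 0| ≤ ‖(c : ℂ)‖ / 1 := by
  refine currentMatching_of_analyticIncrement (a := Real.exp) (b := fun x => Real.exp (x + c)) one_pos (Real.exp_pos 0) (Real.exp_pos _)
    (Real.hasDerivAt_exp 0) ?_ (fun _ => (c : ℂ)) (differentiableOn_const _ |>.diffContOnCl) (fun x _ => ?_) (fun z _ => le_rfl)
  · simpa using ((hasDerivAt_id (0:ℝ)).add_const c).exp
  · rw [Real.log_exp, Real.log_exp]; push_cast; ring

variable {P : Type*} [DecidableEq P] (inc : P → P → Prop) [DecidableRel inc]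

/-- **TOY — `HybridNE7` AT THE KEYED GAS OF NO POLYMERS, THROUGH §3** (A6): the empty polymer system with `Z ≡ 1`, (H) at `η = 0`, no source-carrying polymer
((U‑poly) vacuous, `ε = 0`, `R = 1`), `l₀ = 0`, `vol = 1` — every antecedent met, `HybridNE7` exhibited. -/
theorem toy_hybridNE7_noPolymers_analytic :
    ∃ (η Wsh : ℕ → ℝ) (shA shB : ℕ → ℝ → Finset P → ℝ),
      (∀ (K : ℕ) (t : ℝ), |t| ≤ 0 →
        1 - ∑ X ∈ ((fun _ : ℕ => (∅ : Finset P)) K).powerset with IsCompatible inc X,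
          Real.sqrt (((∏ γ ∈ X, (fun (_ : ℕ) (_ : ℝ) (_ : P) => (1:ℝ)) K t γ)
              / ∑ Y ∈ ((fun _ : ℕ => (∅ : Finset P)) K).powerset with IsCompatible inc Y, ∏ γ ∈ Y, (fun (_ : ℕ) (_ : ℝ) (_ : P) => (1:ℝ)) K t γ)
            * ((∏ γ ∈ X, (fun (_ : ℕ) (_ : ℝ) (_ : P) => (1:ℝ)) K t γ)
              / ∑ Y ∈ ((fun _ : ℕ => (∅ : Finset P)) K).powerset with IsCompatible inc Y, ∏ γ ∈ Y, (fun (_ : ℕ) (_ : ℝ) (_ : P) => (1:ℝ)) K t γ)) ≤ η K) ∧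
      Summable (fun K => Real.sqrt (η K)) ∧
      (∀ K, 0 ≤ Wsh K ∧ Wsh K ≤ Real.sqrt (2 * η K) ∧ Wsh K < 1) ∧
      HybridNE7 0 1 (fun K => ((fun _ : ℕ => (∅ : Finset P)) K).powerset.filter (fun X => IsCompatible inc X))
        (fun K t X => ∏ γ ∈ X, (fun (_ : ℕ) (_ : ℝ) (_ : P) => (1:ℝ)) K t γ) (fun K t X => ∏ γ ∈ X, (fun (_ : ℕ) (_ : ℝ) (_ : P) => (1:ℝ)) K t γ)
        (fun _ _ => ∅) (fun _ => 0) shA shB Wsh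
        (fun K => 0 * (((0:ℕ) : ℝ) * ((fun _ : ℕ => (0:ℝ)) K / 1) + 2 * Real.sqrt (2 * η K) * ((0:ℝ) * ((0:ℕ) : ℝ))) / 1) := by
  have hT := keyedCarrier_empty inc
  refine exists_hybridNE7_keyedGas_of_affinityDefectLetter_analyticIncrements inc le_rfl one_pos (fun _ => ∅)
    (fun _ _ _ => (1:ℝ)) (fun _ _ _ => (1:ℝ)) (fun _ _ _ => 0) (fun _ _ _ => 0)
    (fun _ _ _ γ hγ => absurd hγ (notMem_empty γ)) (fun _ _ _ γ hγ => absurd hγ (notMem_empty γ))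
    (fun _ _ _ γ hγ => absurd hγ (notMem_empty γ)) (fun _ _ _ γ hγ => absurd hγ (notMem_empty γ))
    (Z := fun _ _ => 1) (fun _ _ _ => by simp [hT]) (fun _ _ _ => by simp [hT])
    ⟨fun _ => 0, fun _ => le_rfl, by simp [summable_zero], fun _ _ _ => by simp [hT]⟩
    (fun _ => ∅) (M₀ := 0) le_rfl 0
    (fun _ _ _ γ hγ => absurd hγ (notMem_empty γ)) (fun _ _ _ γ hγ => absurd hγ (notMem_empty γ))
    (fun _ _ _ γ hγ => absurd hγ (notMem_empty γ))
    one_pos (fun _ => 0) (fun _ => le_rfl) summable_zero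
    (fun _ _ _ γ hγ => absurd hγ (notMem_empty γ)) (fun _ X _ => by simp)

end Toys

end Summit.QuantumFields.YangMills.BalabanUVNodes.N20KeyedGasCurrentMatchingOfAnalyticIncrement

end
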